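import Summits.Ventures.PackingBounds.Energy.GramPSDCriteria
import HarnessLib

/-!
# Kernel-checkable PSD certificates from integer data (`Y = L Lᵀ + E`, `E` diagonally dominant)

Framing: lottery ticket; floor = certified bounds/negative ranges. Venture `PackingBounds`, cell
`pub-packcert`, energy family E3PT (pub-packcert-energy gen 11) — KERNEL-D6 steps 2–3.

Integer matrices are lists of rows (`List (List ℤ)`, entry `ent M i j`, `0` outside). The Boolean checkers
`checkRows` (row chunk of the identity `Y_{ij} = Σ_{c<s} L_{ic} L_{jc} + E_{ij}` and `E_{ij} = E_{ji}`) and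
`checkDD` (`Σ_{j<r} |E_{ij}| ≤ 2 E_{ii}`) are meant to be discharged by `decide +kernel` on explicit data, one
theorem per chunk of rows (a 77 × 77 block with 114-bit entries checks in ≈ 3 min in 7 chunks; a single
chunk of 77 rows exceeds the kernel's memory bound). `psd_of_checks` turns the checked facts into
`∀ y, 0 ≤ Σ_{i,j<r} Y_{ij} y_i y_j` over `ℝ` via `GramPSD.quadForm_split_nonneg` — no polynomial identity is
ever expanded.
-/

namespace Summit.Ventures.PackingBounds.Energy.GramData

open Finset

/-- Entry `(i,j)` of a list-of-rows integer matrix (0 outside). -/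
def ent (M : List (List ℤ)) (i j : ℕ) : ℤ := (M.getD i []).getD j 0

/-- `Σ_{c<s} L_{ic} L_{jc}`, by structural recursion on `s`. -/
def dotRows (L : List (List ℤ)) (i j : ℕ) : ℕ → ℤ
  | 0 => 0
  | s + 1 => dotRows L i j s + ent L i s * ent L j s

/-- `Σ_{c<s} |E_{ic}|`, by structural recursion on `s`. -/
def absRow (E : List (List ℤ)) (i : ℕ) : ℕ → ℤ
  | 0 => 0
  | s + 1 => absRow E i s + ((ent E i s).natAbs : ℤ)

/-- Rows `i0 ≤ i < i1`, columns `j < r`: `Y_{ij} = Σ_{c<s} L_{ic}L_{jc} + E_{ij}` and `E_{ij} = E_{ji}`. -/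
def checkRows (r s i0 i1 : ℕ) (Y L E : List (List ℤ)) : Bool :=
  ((List.range i1).filter (fun i => i0 ≤ i)).all fun i => (List.range r).all fun j =>
    (ent Y i j == dotRows L i j s + ent E i j) && (ent E i j == ent E j i)

/-- Diagonal dominance `Σ_{j<r} |E_{ij}| ≤ 2 E_{ii}` for all `i < r`. -/
def checkDD (r : ℕ) (E : List (List ℤ)) : Bool :=
  (List.range r).all fun i => decide (absRow E i r ≤ 2 * ent E i i)

/-- `dotRows` is the finite sum it computes (cast to `ℝ`). -/
theorem dotRows_eq (L : List (List ℤ)) (i j : ℕ) :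
    ∀ s, (dotRows L i j s : ℝ) = ∑ c ∈ Finset.range s, ((ent L i c : ℝ) * (ent L j c : ℝ))
  | 0 => by simp [dotRows]
  | s + 1 => by
    rw [dotRows, Finset.sum_range_succ, Int.cast_add, Int.cast_mul, dotRows_eq L i j s]

/-- `absRow` is the finite sum it computes (cast to `ℝ`). -/
theorem absRow_eq (E : List (List ℤ)) (i : ℕ) :
    ∀ s, (absRow E i s : ℝ) = ∑ c ∈ Finset.range s, |((ent E i c : ℝ))|
  | 0 => by simp [absRow]
  | s + 1 => by
    rw [absRow, Finset.sum_range_succ, Int.cast_add, absRow_eq E i s, Int.natCast_natAbs, Int.cast_abs]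

/-- Unpack a checked row chunk. -/
theorem of_checkRows {r s i0 i1 : ℕ} {Y L E : List (List ℤ)} (h : checkRows r s i0 i1 Y L E = true) :
    ∀ i j, i0 ≤ i → i < i1 → j < r →
      ent Y i j = dotRows L i j s + ent E i j ∧ ent E i j = ent E j i := by
  intro i j hi0 hi1 hj
  simp only [checkRows, List.all_eq_true, List.mem_filter, List.mem_range, decide_eq_true_eq,
    Bool.and_eq_true, beq_iff_eq] at h
  exact h i ⟨hi1, hi0⟩ j hj

/-- Unpack a checked diagonal-dominance fact. -/
theorem of_checkDD {r : ℕ} {E : List (List ℤ)} (h : checkDD r E = true) :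
    ∀ i, i < r → absRow E i r ≤ 2 * ent E i i := by
  intro i hi
  simp only [checkDD, List.all_eq_true, List.mem_range, decide_eq_true_eq] at h
  exact h i hi

/-- **PSD from checked integer data.** If `Y_{ij} = Σ_{c<s} L_{ic}L_{jc} + E_{ij}`, `E_{ij} = E_{ji}` for all
`i, j < r` and `Σ_{j<r}|E_{ij}| ≤ 2E_{ii}` for all `i < r`, then `Σ_{i,j<r} Y_{ij} y_i y_j ≥ 0` for every real
`y`. (The hypotheses are exactly what `of_checkRows` / `of_checkDD` deliver from `decide`d chunks.) -/
theorem psd_of_checks (r s : ℕ) (Y L E : List (List ℤ))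
    (hrows : ∀ i j, i < r → j < r → ent Y i j = dotRows L i j s + ent E i j ∧ ent E i j = ent E j i)
    (hdd : ∀ i, i < r → absRow E i r ≤ 2 * ent E i i) (y : Fin r → ℝ) :
    0 ≤ ∑ i : Fin r, ∑ j : Fin r, (ent Y i j : ℝ) * y i * y j := by
  refine GramPSD.quadForm_split_nonneg (ι := Fin r) (κ := Fin s)
    (fun i j => (ent Y i j : ℝ)) (fun i j => (ent E i j : ℝ)) (fun i c => (ent L i c : ℝ)) ?_ ?_ ?_ y
  · intro i j
    have h := (hrows i j i.2 j.2).1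
    have hc : (ent Y i j : ℝ) = (dotRows L i j s : ℝ) + (ent E i j : ℝ) := by exact_mod_cast h
    rw [hc, dotRows_eq, Fin.sum_univ_eq_sum_range (fun c => (ent L i c : ℝ) * (ent L j c : ℝ)) s]
  · intro i j
    exact_mod_cast (hrows i j i.2 j.2).2
  · intro i
    have h := hdd i i.2
    have hc : (absRow E i r : ℝ) ≤ 2 * (ent E i i : ℝ) := by exact_mod_cast h
    rw [absRow_eq, ← Fin.sum_univ_eq_sum_range (fun c => |((ent E i c : ℝ))|) r] at hc
    exact hc

end Summit.Ventures.PackingBounds.Energy.GramData
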